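import Mathlib
import HarnessLib
import HarnessLib.Audit
import Summits.NavierStokesRegularity.Statement
import Literature.Analysis.FluidPDE.ClassicalSolution
import Literature.Analysis.FluidPDE.LerayHopf
import Literature.Analysis.FluidPDE.SuitableWeak
import Literature.Analysis.FluidPDE.VectorCalculus
import Literature.Analysis.FluidPDE.NSWave0
import Summits.NavierStokesRegularity.NavierStokesRegularity.Theorems.TypeICertificateLadderNoBlowupToClay
import HarnessLib.Audit.Status.Attr

/-!
Route: AdaptedFrequency

Route AdaptedFrequency — NavierStokesRegularity (Clay A), positive side; realises idea card
NavierStokesRegularity/NavierStokesRegularity/adapted-gaussian-log-convexity ("Frequency, not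
energy").

THESIS X ("it suffices to show"): X := NoTypeIBlowup ∧ NoTypeII, where the Type-I half is delivered
by a
FREQUENCY (not energy) monotonicity mechanism:
  NoTypeIBlowup — every finite-energy (Leray–Hopf) classical solution of unforced NS on ℝ³×[0,T)
from a rapidly
  decaying datum whose blow-up rate at T is at most self-similar, ‖u(t)‖∞ ≤ C(T−t)^{-1/2}, extends
smoothly past T;
  NoTypeII — the shared crux stmt-NavierStokesRegularity-0056 of route TypeILiouville (maximal ⇒
Type-I rate).
Lean (Target item NoTypeIBlowup; elaborates, Sketch.lean rc 0):
  ∀ (ν T : ℝ), 0 < ν → 0 < T → ∀ u p, Literature.Analysis.FluidPDE.IsClassicalNSSolutionOn (Set.Ico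
0 T) ν 0 u p →
    Literature.Analysis.FluidPDE.IsLerayHopfOn T ν 0 (u 0) u →
Literature.Analysis.FluidPDE.HasRapidSpatialDecay (u 0) →
    Literature.Analysis.FluidPDE.IsTypeIBlowup u T →
Literature.Analysis.FluidPDE.HasSmoothExtensionPast ν 0 u T
and X → NavierStokesRegularity through NoBlowup (stmt-0054 shape, pure logic: noBlowup_of in
Sketch.lean) and the
shared local-theory assembly NoBlowupToClay = stmt-NavierStokesRegularity-0055.

HOW NoTypeIBlowup IS TO BE SHOWN (two-layer plan, D-0019). Layer 1 = four route statements + one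
classical support:
 (rank 2, crux) AdaptedFrequencyConverges — at a backward-singular point (T,x₀) of a Type-I
solution, for every
   FLOW-ADAPTED BACKWARD KERNEL G (C², G>0, ∂ₜG + u·∇G + νΔG = 0, ∫G = 1, G(t) ⇀ δ_{x₀} as t↑T,
two-sided
   Gaussian-comparable) the ADAPTED FREQUENCY Λ(t) = (T−t)H′(t)/H(t) of the adapted enstrophy
   H(t) = ∫‖curl u(t)‖² G(t) dx converges as t↑T.  [card: log H convex in s = −log(T−t) modulo an
integrable
   defect — vortex stretching is a symmetric operator in L²(G dx); Type I bounds Λ above ⇒ Λ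
converges]
 (rank 3, crux) FrequencyRigidity — NO smooth ancient flow on ℝ³×(−∞,0) with |v| ≤ C(−t)^{-1/2}, an
adapted
   comparable kernel at (0,0), positive adapted enstrophy and CONSTANT adapted frequency exists
   [equality case ⇒ backward self-similar (mod Galilei wobble) ⇒ Tsai/NRŠ (PROVED in tree) ⇒ curl v
≡ 0].
 (rank 4, crux) AdaptedKernelExists — under the Type-I rate an adapted kernel ending at any (T,x₀)
exists and is
   two-sided Gaussian-comparable uniformly down to T (critical divergence-free drift).
 (rank 5, crux, shared) NoTypeII = stmt-0056.
 (support) TangentFlowTransfer (Type-I compactness carries G, H, Λ to a tangent flow with Λ̄ ≡ lim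
Λ; nontrivial by
   persistence of singularities, PROVED in tree), SingularPointExists (maximal ⇒ a backward-singular
point),
   NoBlowupToClay (= stmt-0055), TypeIGlue and Assembly (both PURE LOGIC, proved in Sketch.lean).
Layer 2 (later, by glued splits once a crux closes): AdaptedFrequencyConverges ⇐ kernel calculus
(H′, H″ identities)
∧ Agmon–Nirenberg quasi-convexity with explicit defect ∧ NS-structural summability of the defect;
FrequencyRigidity ⇐
equality case ⇒ self-similar ∧ bounded-profile Tsai theorem (q = ∞).

Rationale: WHY THIS LINE. Blow-up analysis of geometric flows kills Type-I singularities with a MONOTONE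
quantity whose equality
case is self-similarity (Huisken's Gaussian density for MCF; Perelman's reduced volume / Naber
arXiv:0710.5579 and
Enders–Müller–Topping arXiv:1005.1624 for Ricci flow: Type I ⇒ non-flat gradient shrinker), then
classifies the
shrinkers. For NS the shrinker list is already EMPTY (NecasRuzickaSverak1996, Tsai1998 —
necas_ruzicka_sverak_holds,
tsai_selfsimilar_holds, tsai_selfsimilar_local_energy_holds are PROVED in tree), and what is missing
is the monotone
quantity: NS is not a gradient flow, so Giga–Kohn weighted ENERGY monotonicity
(doi:10.1002/cpa.3160380304) is
unavailable, and every Gaussian-weighted energy identity (Leray 1934, NRŠ) is spoiled by the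
critical radial-flux /
head-pressure term. The card's move: use FREQUENCY instead of energy (Almgren–Poon: Poon1996 =
doi:10.1080/03605309608821195,
Agmon–Nirenberg log-convexity: AgmonNirenberg1963, Kukavica doi:10.1090/s0002-9939-07-08991-5),
computed for the
VORTICITY (no pressure) against the FLOW-ADAPTED backward kernel G (adjoint advection–diffusion
density = Constantin–Iyer
backward particle density, arXiv:math/0511067), which removes transport from the first variation
EXACTLY:
H′ = 2∫(ω·Sω − ν|∇ω|²)G. In L²(G dx) vortex stretching is a symmetric multiplication operator (S =
Sᵀ), so it sits on
the log-convex side; only transport relative to the dilation field and unsteadiness of the rescaled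
strain resist,
and both vanish on self-similar flows. Imported: unique-continuation technology
(frequency/log-convexity), stochastic
Lagrangian duality (the kernel), Ricci-flow blow-up dictionary (Type I ⇒ shrinker ⇒ classification).
No probabilistic
reformulation of the STATEMENT is used; the probability enters only through the kernel.
RANKED CRUXES. #2 AdaptedFrequencyConverges (X_C; hardest, most informative: its negation is a
Type-I blow-up with
oscillating adapted frequency, i.e. DSS-type ¬Clay A). #3 FrequencyRigidity (equality case + Tsai
endgame as one
wobble-invariant Liouville statement with a strong hypothesis; much weaker than KNSS (L) =
stmt-0057). #4
AdaptedKernelExists (two-sided Gaussian comparability of the adapted kernel down to the singular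
time; critical
div-free drift; unlocks everything, provers should start here). #5 NoTypeII (shared stmt-0056).
Support:
TangentFlowTransfer, SingularPointExists, NoBlowupToClay (0055), TypeIGlue + Assembly (pure logic,
proved in sketch). NUMBERS. Λ ≡ 2 on backward self-similar flows; Λ is 2log λ-periodic on λ-DSS
flows; abstract defect ≤ c·C per unit
log-time for Type-I constant C (non-integrable by exactly the critical margin); known Liouville
cases: NRŠ L³, Tsai L^q
(3<q≤∞) and local-energy, Chae–Wolf DSS window 1<λ<λ*(C) (arXiv:1610.09464 Thm 1.3); refuted
statements on summit: 0.
KILL CRITERIA. (a) A nontrivial Type-I λ-DSS ancient mild solution (¬TypeIDSSLiouville; Tsai Conj.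
8.8,
BradshawTsai2017CPDE OP 5.1) with non-constant log-periodic adapted enstrophy refutes #2 for its
blow-up and, with
exact power-law enstrophy, #3 — close the route `refuted`. (b) An explicit divergence-free Type-I
drift whose adjoint
kernel is not Gaussian-comparable refutes #4 — pivot to block-wise (dyadic) frequency or close. (c)
Numerics (kit):
Λ on Hou's nearly self-similar axisymmetric fields (arXiv:2107.06509) oscillating with non-summable
down-variation is
strong evidence against #2 (axisymmetric Type I is excluded anyway, so this tests the SIGN
structure, not the
conclusion). (d) A linear counterexample (vector heat equation, critical self-similar div-free
drift, symmetric
potential, bounded non-convergent Λ) does not kill: it certifies that #2 must use u =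
Biot–Savart(ω). (e) Type II
blow-up from Schwartz data kills NoTypeII and Clay (A).
DELIBERATELY NOT DECOMPOSED: the second-variation identity for H″ (|Sω|² − ω·∇²p·ω, ∇u∗∇ω∗∇ω,
ν-cross terms), the
abstract Agmon–Nirenberg lemma with explicit defect and its by-products (small Type-I constant ⇒
regular, which is
Leray's rate bound leray_blowup_rate_top; an explicit Chae–Wolf window from the oscillation budget
of Λ), the
similarity-variable formulation, the backward-uniqueness content of the equality case, the
mildness/pressure
bookkeeping inside TangentFlowTransfer (SelfSimilarLiouville.lean warning on b(t)). Definition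
requested:
IsAdaptedBackwardKernel (Literature/Analysis/FluidPDE) so that the four kernel-bearing items can
later be restated
compactly; today they carry the five kernel clauses inline and all elaborate (Sketch.lean rc 0).

Novelty: NOVELTY (search-before-claim, 2026-08-15; lit searchd local index down (rc 75), remote cascade used:
zbMATH, Crossref,
Semantic Scholar; arXiv/OpenAlex rate-limited; `lit vsearch` on the mechanism sentence (0 relevant
of 8); `lit galaxy
search "frequency function Navier-Stokes" / "logarithmic convexity Navier-Stokes" --star all` (0
rows); `lit frontier
NavierStokesRegularity --since 2020`; in-tree routes (7) and the 117 idea cards).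
Nearest prior art FOUND: (1) parabolic frequency / log-convexity as unique-continuation technology —
Poon CPDE 21 (1996)
doi:10.1080/03605309608821195; Agmon–Nirenberg CPAM 16 (1963) doi:10.1002/cpa.3160160204; Kukavica
PAMS 135 (2007)
doi:10.1090/s0002-9939-07-08991-5 (log–log convexity with non-symmetric part as defect, backward
uniqueness for
NS-type equations); Escauriaza–Fernández–Vessella doubling arXiv:math/0611462; Colding–Minicozzi
parabolic frequency
on manifolds doi:10.1093/imrn/rnab052; NEW since the card: Sun–Wang arXiv:2512.10139
(almost-monotone parabolic
frequency on GAUSSIAN spaces with backward Mehler-kernel weight — heat/Ornstein–Uhlenbeck side only,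
no fluid
equation) and Huang–Karakhanyan arXiv:2511.02579 (a MONOTONICITY FORMULA excluding almost
self-similar behaviour of
suitable weak solutions of the STATIONARY Navier–Stokes system in ℝ⁵ under finite lower local
Reynolds number —
the closest "monotonicity ⇒ no (almost) self-similar singularity" result for any Navier–Stokes
system, but elliptic,
5-D, velocity-level, Euler-homo  [refs: 10.1080/03605309608821195, 10.1002/cpa.3160160204, 10.1090/s0002-9939-07-08991-5, 10.1093/imrn/rnab052, 10.1002/cpa.3160380304, math/0611462, 2512.10139, 2511.02579, math/0511067, 0710.5579, 1005.1624, doi:10.1080/03605309608821195, doi:10.1002/cpa.3160160204, doi:10.1090/s0002-9939-07-08991-5, doi:10.1093/imrn/rnab052, doi:10.1002/cpa.3160380304, NecasRuzickaSverak1996, Tsai1998, KochNadirashvili]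

Barriers (technique_class: frequency-monotonicity log-convexity type-I-exclusion): technique_class: frequency-monotonicity log-convexity type-I-exclusion
- Literature.Barriers.NavierStokesRegularity.TaoAveragedBlowup: NOT evaded by the abstract layer and
the route says so: the structure-blind Agmon–Nirenberg quasi-convexity lemma uses only coefficient
sizes, applies verbatim to an averaged bilinear form, and fails by exactly the critical margin
(defect ≤ c·C per unit log-time, non-integrable). AdaptedFrequencyConverges must therefore use fine
structure Tao names as admissible: (a) u = Biot–Savart(ω) (the drift is generated by the evolving
quantity), (b) the exact TRANSPORT form of the nonlinearity, which is what lets an adapted kernel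
cancel it identically (an averaged B̃ is not a transport and admits no adapted kernel), (c)
pointwise symmetry of the strain. Tao's witness is Type II (arXiv:1402.0290 p.8 fn.), outside the
Type-I hypothesis of every route statement; NoTypeII (shared 0056) carries that exposure exactly as
in TypeILiouville.
- Literature.Barriers.NavierStokesRegularity.TruncatedDyadicBlowup: same accounting; in addition the
defect of the log-convexity inequality is controlled by the TIME-DERIVATIVE of the generator (∂ₛ of
the rescaled strain), so the argument is NOT insensitive to (discontinuous) time-dependence of the
nonlinearity — an exogenously switched coupling has unbounded generator variation and the lemma
gives nothing there, consistently with the barrier.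
- Literature.Barriers.NavierStokesRegularity.TruncatedDyadicTypeIBlowup: the face

Novelty grade: new-combination — Refuter route-review gen-1 (4400e3b7), 2026-08-15. new-combination = (A) unique-continuation technology (Almgren–Poon parabolic frequency / Agmon–Nirenberg log-convexity with non-symmetric defect: Poon 1996, A–N 1963, Kukavica 2007; ESS 2003 already used backward-uniqueness UC on the VORTICITY equat (refuter refuter-rreview-route-AnomalousDissipati-4400e3b7-0, 2026-08-15T13:56:33Z; prior: doi:10.1080/03605309608821195 (Poon 1996 parabolic frequency), doi:10.1002/cpa.3160160204 (Agmon-Nirenberg 1963 log-convexity), doi:10.1090/s0002-9939-07-08991-5 (Kukavica 2007 log-log convexity, backward uniqueness), EscauriazaSereginSverak2003 (backward uniqueness for the vorticity equation in blow-up analysis), KochNadirashviliSereginSverak2009 (Type I => ancient solution => Liouville), Tsai199)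

History (route lifecycle, newest last):
- 2026-08-15T16:17:19Z · rev 3: restated AdaptedFrequencyConverges (stmt-NavierStokesRegularity-2954), TangentFlowTransfer (stmt-NavierStokesRegularity-2957), SingularPointExists (stmt-NavierStokesRegularity-2958) — route-repair (cone re-route, planner rbadge g2): restate AdaptedFrequencyConverges (2954), TangentFlowTransfer (2957), SingularPo (planner-rbadge-NavierStokesRegularity-AdaptedF-b3f1f0f4-g2-0)

sub-problem: NavierStokesRegularity · status: open · opened planner-plancard-NavierStokesRegularity-Navie-febe8024-0 2026-08-15T11:09:44Z · rev 3 · ledger route-NavierStokesRegularity-AdaptedFrequency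
GENERATED by the gate from the ledger (D-0016/17). Provers cite these decls: `theorem foo : Summit.NavierStokesRegularity.NavierStokesRegularity.Theses.AdaptedFrequency.<Decl> := …` in Summits/NavierStokesRegularity/NavierStokesRegularity/Theorems/<Name>.lean.
-/

namespace Summit.NavierStokesRegularity.NavierStokesRegularity.Theses.AdaptedFrequency

open scoped BigOperators Topology Manifold Classical MeasureTheory ProbabilityTheory Matrix InnerProductSpace ComplexConjugate ContinuousMap
open Filter Set Function TopologicalSpace MeasureTheory

attribute [summit_statement] _root_.NavierStokesRegularity

open Literature.NS

/-- item stmt-NavierStokesRegularity-1217 · target · rank 0 · open · by planner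
why it might fail: A Type-I (e.g. backward discretely self-similar) blow-up from Schwartz data refutes it (= ¬Clay A): Type-I DSS profiles are excluded only for λ near 1 (ChaeWolf2017RemovingDSS Thm 1.3) and conjecturally in general (BradshawTsai2017CPDE OP 5.1); only axisymmetric Type I is excluded.
sources: KochNadirashviliSereginSverak2009, SereginSverak2009, AlbrittonBarker2019, BradshawTsai2017CPDE, ChaeWolf2017RemovingDSS, 1811.00502
[target] X = NO TYPE-I BLOW-UP FOR CLAY DATA: a classical solution of unforced NS on ℝ³×[0,T) which
is Leray–Hopf from a rapidly decaying datum and blows up at most at the Type-I rate ‖u(t)‖∞ ≤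
C(T−t)^{-1/2} extends smoothly past T. Equals UnthreadedNoBlowup ∧ ThreadedNoBlowup by excluded
middle on 'every point is unthreaded' (proved in the planner's Sketch.lean: target_of_cruxes); it is
the unconditional conclusion of stmt-NavierStokesRegularity-0058 (route TypeILiouville, which
assumes (L)). With NoTypeII (stmt-0056) it gives NoBlowup (stmt-0054). Card:
threading-flux-trace-topology. -/
@[route_item "route-NavierStokesRegularity-AdaptedFrequency", crux]
def NoTypeIBlowup : Prop :=
  ∀ (ν T : ℝ), 0 < ν → 0 < T → ∀ (u : ℝ → EuclideanSpace ℝ (Fin 3) → EuclideanSpace ℝ (Fin 3)) (p : ℝ → EuclideanSpace ℝ (Fin 3) → ℝ), Literature.Analysis.FluidPDE.IsClassicalNSSolutionOn (Set.Ico 0 T) ν 0 u p → Literature.Analysis.FluidPDE.IsLerayHopfOn T ν 0 (u 0) u → Literature.Analysis.FluidPDE.HasRapidSpatialDecay (u 0) → Literature.Analysis.FluidPDE.IsTypeIBlowup u T → Literature.Analysis.FluidPDE.HasSmoothExtensionPast ν 0 u T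

-- earlier AdaptedFrequencyConverges (stmt-NavierStokesRegularity-2954, replaced 2026-08-15T16:17:19Z -> stmt-NavierStokesRegularity-10493): retired by None — ∀ (ν T : ℝ), 0 < ν → 0 < T → ∀ (u : ℝ → EuclideanSpace ℝ (Fin 3) → EuclideanSpace ℝ (Fin 3)) (p : ℝ → EuclideanSpace ℝ (Fin 3) → ℝ), Literature.Analysis.FluidPDE.IsClassicalNSSolutionOn (Set.Ico 0 T) ν 0 u p → Literature.Analysis.FluidPDE.IsLer
/-- item stmt-NavierStokesRegularity-10493 · crux · rank 2 · open · by planner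
why it might fail: A Type-I λ-DSS blow-up from Schwartz data has log-periodic, generically non-constant Λ (not excluded: BradshawTsai2017CPDE OP 5.1; Hou's nearly self-similar numerics arXiv:2107.06509); the abstract Agmon–Nirenberg defect is critical (≈C per unit log-time), not summable by size alone.
sources: Poon1996, AgmonNirenberg1963, 10.1090/s0002-9939-07-08991-5, math/0511067, BradshawTsai2017CPDE, ChaeWolf2017RemovingDSS
[crux] X_C of idea card adapted-gaussian-log-convexity, in the form the assembly consumes. Setting:
(u,p) classical NS on ℝ³×[0,T), Leray–Hopf from a rapidly decaying datum, Type-I rate at T, (T,x₀) a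
backward-singular point — INLINED here as `∀ r>0, eLpNorm (uncurry u) ⊤ (volume.restrict
(parabolicCylinder r (T,x₀))) = ⊤`, the definitional unfolding of
Literature.Analysis.FluidPDE.IsBackwardSingularPoint u (T,x₀) (so the route file no longer imports
LocalTypeI); G a FLOW-ADAPTED BACKWARD KERNEL on [t₀,T) — the five inline clauses: C² on [t₀,T)×ℝ³,
G>0, adjoint equation ∂ₜG + u·∇G + νΔG = 0 (adjoint of ∂ₜ + u·∇ − νΔ because div u = 0), unit mass
∫G(t) = 1, concentration G(t)dx ⇀ δ_{x₀} as t↑T — which is moreover two-sided Gaussian-comparable at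
scale √(T−t) about x₀. Adapted enstrophy H(t) = ∫‖curl u(t)‖² G(t) dx; adapted frequency Λ(t) =
(T−t)·H′(t)/H(t) (Mathlib deriv; transport-free first variation H′ = 2∫(ω·Sω − ν|∇ω|²)G; backward
self-similar blow-up ⇒ Λ ≡ 2, λ-DSS ⇒ Λ is 2log λ-periodic in s = −log(T−t)). CLAIM: Λ(t) converges
as t↑T. Intended mechanism (the card): log H is convex in s up to an integrable defect —
Almgren–Poon frequency monotonicity / Agmon–Nirenberg log-conv -/
@[route_item "route-NavierStokesRegularity-AdaptedFrequency", crux]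
def AdaptedFrequencyConverges : Prop :=
  ∀ (ν T : ℝ), 0 < ν → 0 < T → ∀ (u : ℝ → EuclideanSpace ℝ (Fin 3) → EuclideanSpace ℝ (Fin 3)) (p : ℝ → EuclideanSpace ℝ (Fin 3) → ℝ), Literature.Analysis.FluidPDE.IsClassicalNSSolutionOn (Set.Ico 0 T) ν 0 u p → Literature.Analysis.FluidPDE.IsLerayHopfOn T ν 0 (u 0) u → Literature.Analysis.FluidPDE.HasRapidSpatialDecay (u 0) → Literature.Analysis.FluidPDE.IsTypeIBlowup u T → ∀ (x₀ : EuclideanSpace ℝ (Fin 3)) (t₀ : ℝ) (G : ℝ → EuclideanSpace ℝ (Fin 3) → ℝ), t₀ ∈ Set.Ico 0 T → (∀ r : ℝ, 0 < r → MeasureTheory.eLpNorm (Function.uncurry u) ⊤ (MeasureTheory.Measure.restrict MeasureTheory.volume (Literature.Analysis.FluidPDE.parabolicCylinder r (T, x₀))) = ⊤) → ContDiffOn ℝ 2 (Function.uncurry G) (Set.Ico t₀ T ×ˢ Set.univ) ∧ (∀ t ∈ Set.Ico t₀ T, ∀ x, 0 < G t x) ∧ (∀ t ∈ Set.Ico t₀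 T, ∀ x, Literature.Analysis.FluidPDE.timeDerivWithin (Set.Ico t₀ T) G t x + fderiv ℝ (G t) x (u t x) + ν * Laplacian.laplacian (G t) x = 0) ∧ (∀ t ∈ Set.Ico t₀ T, ∫ x, G t x = 1) ∧ (∀ φ : EuclideanSpace ℝ (Fin 3) → ℝ, Continuous φ → (∃ M : ℝ, ∀ x, |φ x| ≤ M) → Filter.Tendsto (fun t => ∫ x, φ x * G t x) (nhdsWithin T (Set.Iio T)) (nhds (φ x₀))) → (∃ c₁ c₂ C₁ C₂ : ℝ, 0 < c₁ ∧ 0 < c₂ ∧ 0 < C₁ ∧ 0 < C₂ ∧ ∀ t ∈ Set.Ico t₀ T, ∀ x, c₁ * (T - t) ^ (-(3:ℝ) / 2) * Real.exp (-(‖x - x₀‖ ^ 2) / (c₂ * (T - t))) ≤ G t x ∧ G t x ≤ C₁ * (T - t) ^ (-(3:ℝ) / 2) * Real.exp (-(‖x - x₀‖ ^ 2) / (C₂ * (T - t)))) → ∀ H Λ : ℝ → ℝ, H = (fun t => ∫ x, ‖Literature.Analysis.FluidPDE.curl (u t) x‖ ^ 2 * G t x) → Λ = (fun t => (T - t) *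 deriv H t / H t) → ∃ Λ₀ : ℝ, Filter.Tendsto Λ (nhdsWithin T (Set.Iio T)) (nhds Λ₀)

/-- item stmt-NavierStokesRegularity-2955 · crux · rank 3 · open · by planner
why it might fail: Λ is one scalar: a Type-I λ-DSS ancient flow whose adapted enstrophy is an exact power of (−t) has constant Λ without being self-similar; such flows are excluded only conjecturally (TypeIDSSLiouvilleConjecture, BradshawTsai2017CPDE OP 5.1; ChaeWolf2017RemovingDSS Thm 1.3: λ<λ*(C) only).
sources: Tsai1998, NecasRuzickaSverak1996, BradshawTsai2017CPDE, ChaeWolf2017RemovingDSS, KochNadirashviliSereginSverak2009, Poon1996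
Equality-case rigidity fused with the NRŠ/Tsai endgame into ONE Liouville-type non-existence
statement, so that (i) it is invariant under the generalized Galilei wobble v(x−B(t),t)+B′(t) — to
which H and Λ are blind and which the in-tree duality-form mild class does not pin
(SelfSimilarLiouville.lean, warning on b(t)) — and (ii) its proof rests on PROVED cone facts. CLAIM:
there is NO smooth ancient NS flow (v,q) on ℝ³×(−∞,0) (any ν>0) with the Type-I bound |v(x,t)| ≤
C(−t)^{-1/2} for all t<0 (note both ends: decay as t→−∞ already kills steady, Beltrami, shear and
caloric families), admitting an adapted kernel K at (0,0) (same five clauses on (−∞,0), two-sided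
Gaussian-comparable), whose adapted enstrophy H(t) = ∫‖curl v(t)‖²K(t) is positive for all t<0 and
whose adapted frequency Λ(t) = (−t)H′/H is CONSTANT on (−∞,0). Expected proof: constant Λ is the
equality case of the log-convexity inequality ⇒ the similarity-variable vorticity evolves by pure
scaling (∂_σω̃ ∥ ω̃ in L²(K)) ⇒ v is backward self-similar about (0,0) up to wobble, with BOUNDED
Leray profile U; then Tsai 1998 Thm 1 (q = ∞: bounded profiles are constant; in tree
tsai_selfsimilar_holds covers 3<q<∞, necas_ruzicka_sve -/
@[route_item "route-NavierStokesRegularity-AdaptedFrequency", crux]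
def FrequencyRigidity : Prop :=
  ¬ ∃ (ν C Λ₀ : ℝ) (v : ℝ → EuclideanSpace ℝ (Fin 3) → EuclideanSpace ℝ (Fin 3)) (q : ℝ → EuclideanSpace ℝ (Fin 3) → ℝ) (K : ℝ → EuclideanSpace ℝ (Fin 3) → ℝ), 0 < ν ∧ Literature.Analysis.FluidPDE.IsClassicalNSSolutionOn (Set.Iio 0) ν 0 v q ∧ (∀ t ∈ Set.Iio (0:ℝ), ∀ x, ‖v t x‖ ≤ C / Real.sqrt (-t)) ∧ ContDiffOn ℝ 2 (Function.uncurry K) (Set.Iio (0:ℝ) ×ˢ Set.univ) ∧ (∀ t ∈ Set.Iio (0:ℝ), ∀ x, 0 < K t x) ∧ (∀ t ∈ Set.Iio (0:ℝ), ∀ x, Literature.Analysis.FluidPDE.timeDerivWithin (Set.Iio (0:ℝ)) K t x + fderiv ℝ (K t) x (v t x) + ν * Laplacian.laplacian (K t) x = 0) ∧ (∀ t ∈ Set.Iio (0:ℝ), ∫ x, K t x = 1) ∧ (∀ φ : EuclideanSpace ℝ (Fin 3) → ℝ, Continuous φ → (∃ M : ℝ, ∀ x, |φ x| ≤ M) →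 Filter.Tendsto (fun t => ∫ x, φ x * K t x) (nhdsWithin (0:ℝ) (Set.Iio (0:ℝ))) (nhds (φ (0 : EuclideanSpace ℝ (Fin 3))))) ∧ (∃ c₁ c₂ C₁ C₂ : ℝ, 0 < c₁ ∧ 0 < c₂ ∧ 0 < C₁ ∧ 0 < C₂ ∧ ∀ t ∈ Set.Iio (0:ℝ), ∀ x, c₁ * ((0:ℝ) - t) ^ (-(3:ℝ) / 2) * Real.exp (-(‖x - (0 : EuclideanSpace ℝ (Fin 3))‖ ^ 2) / (c₂ * ((0:ℝ) - t))) ≤ K t x ∧ K t x ≤ C₁ * ((0:ℝ) - t) ^ (-(3:ℝ) / 2) * Real.exp (-(‖x - (0 : EuclideanSpace ℝ (Fin 3))‖ ^ 2) / (C₂ * ((0:ℝ) - t)))) ∧ (∀ H Λ : ℝ → ℝ, H = (fun t => ∫ x, ‖Literature.Analysis.FluidPDE.curl (v t) x‖ ^ 2 * K t x) → Λ = (fun t => (0 - t) * deriv H t / H t) → (∀ t ∈ Set.Iio (0:ℝ), 0 < H t) ∧ (∀ t ∈ Set.Iio (0:ℝ), Λ t = Λ₀))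

/-- item stmt-NavierStokesRegularity-2956 · crux · rank 4 · closed · proved by Summit.NavierStokesRegularity.NavierStokesRegularity.Theorems.adaptedFrequency_adaptedKernelExists_proof @ 0daad2f096c9 (prover) · by planner
why it might fail: Two-sided bounds uniform down to the singular time are a critical-drift heat-kernel problem: at the scale-invariant threshold Harnack can fail (SSSZ arXiv:1010.6025); known Aronson bounds need L∞(BMO⁻¹) drift (Qian–Xi arXiv:1612.07727); a time-only Type-I bound is not uniformly BMO⁻¹.
sources: 1010.6025, 1612.07727, 10.1215/s0012-7094-95-08110-1, math/0511067, 10.1080/00036810500277082, LadyzhenskayaSolonnikovUraltseva1968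
Kernel calculus at the singular time (card item 1, flagged 'crux-adjacent, not provable-now' by the
novelty audit, hence a crux): for (u,p) classical, Leray–Hopf, rapidly decaying datum, Type-I rate
at T, and ANY x₀ ∈ ℝ³, there are t₀ ∈ [0,T) and a flow-adapted backward kernel G on [t₀,T) ending at
δ_{x₀} (C², G>0, ∂ₜG + u·∇G + νΔG = 0, ∫G = 1, concentration at x₀) which is TWO-SIDED
GAUSSIAN-COMPARABLE: c₁(T−t)^{-3/2}e^{−|x−x₀|²/(c₂(T−t))} ≤ G(t,x) ≤
C₁(T−t)^{-3/2}e^{−|x−x₀|²/(C₂(T−t))} on [t₀,T)×ℝ³. For T′<T this is the classical fundamental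
solution of a uniformly parabolic equation with smooth bounded drift (Aronson two-sided bounds,
LadyzhenskayaSolonnikovUraltseva1968 Ch. IV); the content is UNIFORMITY as T′↑T under the critical
drift ‖u(t)‖∞ ≤ C(T−t)^{-1/2}. Evidence for: div u = 0 gives the drift-independent Nash/Carlen–Loss
on-diagonal bound G ≤ c(ν(T−t))^{-3/2} (doi:10.1215/s0012-7094-95-08110-1); the backward Lagrangian
particle from (x₀,T) (Constantin–Iyer arXiv:math/0511067, whose density G is) is displaced by the
drift by at most ∫ₜᵀ C(T−s)^{-1/2}ds = 2C√(T−t), i.e. O(C/√ν) standard deviations at EVERY scale,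
and on each dyadic block [T−2h,T−h] the rescaled problem ha -/
@[route_item "route-NavierStokesRegularity-AdaptedFrequency", crux]
def AdaptedKernelExists : Prop :=
  ∀ (ν T : ℝ), 0 < ν → 0 < T → ∀ (u : ℝ → EuclideanSpace ℝ (Fin 3) → EuclideanSpace ℝ (Fin 3)) (p : ℝ → EuclideanSpace ℝ (Fin 3) → ℝ), Literature.Analysis.FluidPDE.IsClassicalNSSolutionOn (Set.Ico 0 T) ν 0 u p → Literature.Analysis.FluidPDE.IsLerayHopfOn T ν 0 (u 0) u → Literature.Analysis.FluidPDE.HasRapidSpatialDecay (u 0) → Literature.Analysis.FluidPDE.IsTypeIBlowup u T → ∀ x₀ : EuclideanSpace ℝ (Fin 3), ∃ t₀ ∈ Set.Ico 0 T, ∃ G : ℝ → EuclideanSpace ℝ (Fin 3) → ℝ, (ContDiffOn ℝ 2 (Function.uncurry G) (Set.Ico t₀ T ×ˢ Set.univ) ∧ (∀ t ∈ Set.Ico t₀ T, ∀ x, 0 < G t x) ∧ (∀ t ∈ Set.Ico t₀ T, ∀ x, Literature.Analysis.FluidPDE.timeDerivWithin (Set.Ico t₀ T) G t x + fderiv ℝ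 (G t) x (u t x) + ν * Laplacian.laplacian (G t) x = 0) ∧ (∀ t ∈ Set.Ico t₀ T, ∫ x, G t x = 1) ∧ (∀ φ : EuclideanSpace ℝ (Fin 3) → ℝ, Continuous φ → (∃ M : ℝ, ∀ x, |φ x| ≤ M) → Filter.Tendsto (fun t => ∫ x, φ x * G t x) (nhdsWithin T (Set.Iio T)) (nhds (φ x₀)))) ∧ (∃ c₁ c₂ C₁ C₂ : ℝ, 0 < c₁ ∧ 0 < c₂ ∧ 0 < C₁ ∧ 0 < C₂ ∧ ∀ t ∈ Set.Ico t₀ T, ∀ x, c₁ * (T - t) ^ (-(3:ℝ) / 2) * Real.exp (-(‖x - x₀‖ ^ 2) / (c₂ * (T - t))) ≤ G t x ∧ G t x ≤ C₁ * (T - t) ^ (-(3:ℝ) / 2) * Real.exp (-(‖x - x₀‖ ^ 2) / (C₂ * (T - t))))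

/-- item stmt-NavierStokesRegularity-0056 · crux · rank 5 · open · by planner
why it might fail: No theorem bounds a blow-up rate from above; Tao's averaged-NS blow-up is Type II (arXiv:1402.0290 p.8 fn.); KNSS2009 p.4: every axisymmetric singularity is Type II, so Hou's axisymmetric candidate (arXiv:2107.06509), if real, refutes it (= ¬Clay A).
sources: Tao2016AveragedNS, KochNadirashviliSereginSverak2009, Hou2022PotentiallySingularNS, Seregin2012CMP, Tao2021QuantitativeNS, 1402.0290
If a finite-energy classical solution from a rapidly decaying datum has maximal lifespan T<∞ (no
classical extension past T), then ‖u(t)‖_∞ ≤ C (T−t)^{-1/2} eventually as t↑T (Leray's rate is the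
matching lower bound, leray_blowup_rate_top). The hardest and most informative crux: a
counterexample is a Type II singularity, i.e. ¬(Clay A). Known: lower bound c√ν (T−t)^{-1/2} (Leray
1934 §20); L³ must blow up (ESS 2003, Seregin 2012); only triple-log quantitative gain (Tao 2021). -/
@[route_item "route-NavierStokesRegularity-AdaptedFrequency", crux]
def NoTypeII : Prop :=
  ∀ (ν T : ℝ), 0 < ν → 0 < T → ∀ (u : ℝ → EuclideanSpace ℝ (Fin 3) → EuclideanSpace ℝ (Fin 3)) (p : ℝ → EuclideanSpace ℝ (Fin 3) → ℝ), Literature.Analysis.FluidPDE.IsMaximalSmoothSolution ν 0 u p T → Literature.Analysis.FluidPDE.IsLerayHopfOn T ν 0 (u 0) u → Literature.Analysis.FluidPDE.HasRapidSpatialDecay (u 0) → Literature.Analysis.FluidPDE.IsTypeIBlowup u T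

/-- item stmt-NavierStokesRegularity-0055 · support · rank 9 · closed · proved by Summit.NavierStokesRegularity.NavierStokesRegularity.Theorems.typeICertificateLadder_noBlowupToClay_proof @ f501e9774e4d (prover) · by planner
sources: Leray1934, LemarieRieusset2002, CKN1982
Given NoBlowup, build the Clay (A) solution: local finite-energy classical solution for smooth
divergence-free rapidly decaying data (Leray 1934 §III / Fujita–Kato 1964 + LPS smoothing), continue
past every T using NoBlowup, glue by weak–strong uniqueness (Prodi–Serrin), bounded energy from the
energy inequality, and convert with
Literature.Analysis.FluidPDE.isNavierStokesSolution_and_smooth_iff. Blow-up at spatial infinity is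
excluded by CKN ε-regularity applied far out. May take named Literature facts (leray_existence_R3,
ladyzhenskaya_prodi_serrin, weak_strong_uniqueness, fujita_kato_local) as hypotheses if the grounder
so rules. -/
@[route_item "route-NavierStokesRegularity-AdaptedFrequency", crux]
def NoBlowupToClay : Prop :=
  (∀ (ν T : ℝ), 0 < ν → 0 < T → ∀ (u : ℝ → EuclideanSpace ℝ (Fin 3) → EuclideanSpace ℝ (Fin 3)) (p : ℝ → EuclideanSpace ℝ (Fin 3) → ℝ), Literature.Analysis.FluidPDE.IsClassicalNSSolutionOn (Set.Ico 0 T) ν 0 u p → Literature.Analysis.FluidPDE.IsLerayHopfOn T ν 0 (u 0) u → Literature.Analysis.FluidPDE.HasRapidSpatialDecay (u 0) → Literature.Analysis.FluidPDE.HasSmoothExtensionPast ν 0 u T) → NavierStokesRegularity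

/-- `NoBlowupToClay` holds: proved by `Summit.NavierStokesRegularity.NavierStokesRegularity.Theorems.typeICertificateLadder_noBlowupToClay_proof` @ f501e9774e4d. -/
theorem NoBlowupToClay_holds : NoBlowupToClay := _root_.Summit.NavierStokesRegularity.NavierStokesRegularity.Theorems.typeICertificateLadder_noBlowupToClay_proof

-- earlier TangentFlowTransfer (stmt-NavierStokesRegularity-2957, replaced 2026-08-15T16:17:19Z -> stmt-NavierStokesRegularity-10494): retired by None — ∀ (ν T : ℝ), 0 < ν → 0 < T → ∀ (u : ℝ → EuclideanSpace ℝ (Fin 3) → EuclideanSpace ℝ (Fin 3)) (p : ℝ → EuclideanSpace ℝ (Fin 3) → ℝ), Literature.Analysis.FluidPDE.IsClassicalNSSolutionOn (Set.Ico 0 T) ν 0 u p → Literature.Analysis.FluidPDE.IsLerayHopf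
/-- item stmt-NavierStokesRegularity-10494 · support · rank 9 · closed · proved by Summit.NavierStokesRegularity.NavierStokesRegularity.Theorems.adaptedFrequency_tangentFlowTransfer_proof @ aa69531c3eff (prover) · by planner
why it might fail: H̄ could vanish on an initial time interval only if the tangent flow were irrotational there; excluding this uses mildness of the limit + unique continuation — bookkeeping (KNSS2009 §6, b(t) normalisation) that is real work.
sources: AlbrittonBarker2019, KochNadirashviliSereginSverak2009, SereginSverak2009, RusinSverak2011, 1811.00502
[support] GLUE by Type-I compactness at the singular point (card item 5). Rescale u_k(y,τ) = λ_k
u(x₀+λ_k y, T+λ_k²τ), p_k, G_k(y,τ) = λ_k³ G(T+λ_k²τ, x₀+λ_k y), λ_k → 0. Type I gives local smooth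
compactness on ℝ³×(−∞,0) (bounded ancient pieces are smooth with bounds, KNSS 2009 §4); the five
kernel clauses and Gaussian comparability are scale-invariant with the SAME constants, so G_k → K,
an adapted comparable kernel of the limit v at (0,0); dominated convergence (Type-I derivative
bounds |∇ʲu| ≲ (T−t)^{-(1+j)/2} + Gaussian tails) gives H_k → H̄ and H_k′ → H̄′ pointwise in τ<0,
hence Λ̄(τ) = lim_k Λ(T+λ_k²τ) = Λ₀ for every τ<0 once Λ(t) → Λ₀. Non-degeneracy: (T,x₀)
backward-singular (hypothesis inlined as ∀ r>0, u ∉ L∞(Q_r(T,x₀)) = IsBackwardSingularPoint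
unfolded) ⇒ the limit is singular at (0,0) by persistence of singularities (AlbrittonBarker2019
Prop. 2.3 = in-tree PersistenceOfSingularities_holds, with SuitableCompactness_holds, both PROVED;
ε-regularity RRS2016.theorem15_3_holds PROVED), in particular v ≢ 0; H̄(τ) > 0 for every τ<0 because
a slice with curl v(τ) ≡ 0 is harmonic and bounded, hence spatially constant, and the (genuinely
mild, pressure-normalised) tangent flow -/
@[route_item "route-NavierStokesRegularity-AdaptedFrequency", crux]
def TangentFlowTransfer : Prop :=
  ∀ (ν T : ℝ), 0 < ν → 0 < T → ∀ (u : ℝ → EuclideanSpace ℝ (Fin 3) → EuclideanSpace ℝ (Fin 3)) (p : ℝ → EuclideanSpace ℝ (Fin 3) → ℝ), Literature.Analysis.FluidPDE.IsClassicalNSSolutionOn (Set.Ico 0 T) ν 0 u p → Literature.Analysis.FluidPDE.IsLerayHopfOn T ν 0 (u 0) u → Literature.Analysis.FluidPDE.HasRapidSpatialDecay (u 0) → Literature.Analysis.FluidPDE.IsTypeIBlowup u T → ∀ (x₀ : EuclideanSpace ℝ (Fin 3)) (t₀ : ℝ) (G : ℝ → EuclideanSpace ℝ (Fin 3) → ℝ),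 t₀ ∈ Set.Ico 0 T → (∀ r : ℝ, 0 < r → MeasureTheory.eLpNorm (Function.uncurry u) ⊤ (MeasureTheory.Measure.restrict MeasureTheory.volume (Literature.Analysis.FluidPDE.parabolicCylinder r (T, x₀))) = ⊤) → ContDiffOn ℝ 2 (Function.uncurry G) (Set.Ico t₀ T ×ˢ Set.univ) ∧ (∀ t ∈ Set.Ico t₀ T, ∀ x, 0 < G t x) ∧ (∀ t ∈ Set.Ico t₀ T, ∀ x, Literature.Analysis.FluidPDE.timeDerivWithin (Set.Ico t₀ T) G t x + fderiv ℝ (G t) x (u t x) + ν * Laplacian.laplacian (G t) x = 0) ∧ (∀ t ∈ Set.Ico t₀ T, ∫ x, G t x = 1) ∧ (∀ φ : EuclideanSpace ℝ (Fin 3) → ℝ, Continuous φ → (∃ M : ℝ, ∀ x, |φ x| ≤ M) → Filter.Tendsto (fun t => ∫ x, φ x * G t x) (nhdsWithin T (Set.Iio T)) (nhds (φ x₀))) → (∃ c₁ c₂ C₁ C₂ : ℝ, 0 < c₁ ∧ 0 < c₂ ∧ 0 < C₁ ∧ 0 < C₂ ∧ ∀ t ∈ Set.Ico t₀ T, ∀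 x, c₁ * (T - t) ^ (-(3:ℝ) / 2) * Real.exp (-(‖x - x₀‖ ^ 2) / (c₂ * (T - t))) ≤ G t x ∧ G t x ≤ C₁ * (T - t) ^ (-(3:ℝ) / 2) * Real.exp (-(‖x - x₀‖ ^ 2) / (C₂ * (T - t)))) → ∀ H Λ : ℝ → ℝ, H = (fun t => ∫ x, ‖Literature.Analysis.FluidPDE.curl (u t) x‖ ^ 2 * G t x) → Λ = (fun t => (T - t) * deriv H t / H t) → ∀ Λ₀ : ℝ, Filter.Tendsto Λ (nhdsWithin T (Set.Iio T)) (nhds Λ₀) → ∃ (C : ℝ) (v : ℝ → EuclideanSpace ℝ (Fin 3) → EuclideanSpace ℝ (Fin 3)) (q : ℝ → EuclideanSpace ℝ (Fin 3) → ℝ) (K : ℝ → EuclideanSpace ℝ (Fin 3) → ℝ), Literature.Analysis.FluidPDE.IsClassicalNSSolutionOn (Set.Iio 0) ν 0 v q ∧ (∀ t ∈ Set.Iio (0:ℝ), ∀ x, ‖v t x‖ ≤ C / Real.sqrt (-t)) ∧ ContDiffOn ℝ 2 (Function.uncurry K) (Set.Iio (0:ℝ) ×ˢ Set.univ) ∧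 (∀ t ∈ Set.Iio (0:ℝ), ∀ x, 0 < K t x) ∧ (∀ t ∈ Set.Iio (0:ℝ), ∀ x, Literature.Analysis.FluidPDE.timeDerivWithin (Set.Iio (0:ℝ)) K t x + fderiv ℝ (K t) x (v t x) + ν * Laplacian.laplacian (K t) x = 0) ∧ (∀ t ∈ Set.Iio (0:ℝ), ∫ x, K t x = 1) ∧ (∀ φ : EuclideanSpace ℝ (Fin 3) → ℝ, Continuous φ → (∃ M : ℝ, ∀ x, |φ x| ≤ M) → Filter.Tendsto (fun t => ∫ x, φ x * K t x) (nhdsWithin (0:ℝ) (Set.Iio (0:ℝ))) (nhds (φ (0 : EuclideanSpace ℝ (Fin 3))))) ∧ (∃ c₁ c₂ C₁ C₂ : ℝ, 0 < c₁ ∧ 0 < c₂ ∧ 0 < C₁ ∧ 0 < C₂ ∧ ∀ t ∈ Set.Iio (0:ℝ), ∀ x, c₁ * ((0:ℝ) - t) ^ (-(3:ℝ) / 2) * Real.exp (-(‖x - (0 : EuclideanSpace ℝ (Fin 3))‖ ^ 2) / (c₂ * ((0:ℝ) - t))) ≤ K t x ∧ K t x ≤ C₁ * ((0:ℝ) - t)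 ^ (-(3:ℝ) / 2) * Real.exp (-(‖x - (0 : EuclideanSpace ℝ (Fin 3))‖ ^ 2) / (C₂ * ((0:ℝ) - t)))) ∧ (∀ H Λ : ℝ → ℝ, H = (fun t => ∫ x, ‖Literature.Analysis.FluidPDE.curl (v t) x‖ ^ 2 * K t x) → Λ = (fun t => (0 - t) * deriv H t / H t) → (∀ t ∈ Set.Iio (0:ℝ), 0 < H t) ∧ (∀ t ∈ Set.Iio (0:ℝ), Λ t = Λ₀))

-- earlier SingularPointExists (stmt-NavierStokesRegularity-2958, replaced 2026-08-15T16:17:19Z -> stmt-NavierStokesRegularity-10495): retired by None — ∀ (ν T : ℝ), 0 < ν → 0 < T → ∀ (u : ℝ → EuclideanSpace ℝ (Fin 3) → EuclideanSpace ℝ (Fin 3)) (p : ℝ → EuclideanSpace ℝ (Fin 3) → ℝ), Literature.Analysis.FluidPDE.IsMaximalSmoothSolution ν 0 u p T → Literature.Analysis.FluidPDE.IsLerayHopfOn T ν 0 (u 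
/-- item stmt-NavierStokesRegularity-10495 · support · rank 9 · closed · proved by Summit.NavierStokesRegularity.NavierStokesRegularity.Theorems.singularPointExists_proof (prover) · by planner
sources: CKN1982, RobinsonRodrigoSadowski2016, Seregin2014Notes, LemarieRieusset2016, Leray1934
[support] Classical support (reusable by TypeILiouville's 0058 and every Type-I-exclusion card): a
MAXIMAL (non-extendable) finite-energy classical solution from a rapidly decaying datum has a
backward-singular point (T,x₀), i.e. u is essentially unbounded on every parabolic cylinder
Q_r(T,x₀) = (T−r²,T)×B_r(x₀) (stated INLINE as ∀ r>0, eLpNorm (uncurry u) ⊤ (volume.restrict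
(parabolicCylinder r (T,x₀))) = ⊤ — the definitional unfolding of
Literature.Analysis.FluidPDE.IsBackwardSingularPoint, so the route file does not import LocalTypeI;
only t<T enters, so the junk slices t ≥ T of u are irrelevant). Ingredients: (i) bounded velocity on
[T−δ,T)×ℝ³ ⇒ smooth continuation past T (local well-posedness for bounded finite-energy smooth data
with existence time depending on ‖u‖∞, weak–strong uniqueness to glue), so maximality forces ess-sup
|u| = ∞ near T; (ii) blow-up cannot escape to spatial infinity for Leray–Hopf solutions: outside a
large ball the local L³×L^{3/2} mass of (u,p) over Q_1 cylinders is small (u ∈ L^{10/3}_{t,x}, p ∈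
L^{5/3}), so the one-scale ε-regularity criterion (CKN 1982 Prop. 1 / Robinson–Rodrigo–Sadowski Thm
15.3 = in-tree RRS2016.theorem15_3_holds, PROVED) bounds -/
@[route_item "route-NavierStokesRegularity-AdaptedFrequency", crux]
def SingularPointExists : Prop :=
  ∀ (ν T : ℝ), 0 < ν → 0 < T → ∀ (u : ℝ → EuclideanSpace ℝ (Fin 3) → EuclideanSpace ℝ (Fin 3)) (p : ℝ → EuclideanSpace ℝ (Fin 3) → ℝ), Literature.Analysis.FluidPDE.IsMaximalSmoothSolution ν 0 u p T → Literature.Analysis.FluidPDE.IsLerayHopfOn T ν 0 (u 0) u → Literature.Analysis.FluidPDE.HasRapidSpatialDecay (u 0) → ∃ x₀ : EuclideanSpace ℝ (Fin 3), (∀ r : ℝ, 0 < r → MeasureTheory.eLpNorm (Function.uncurry u) ⊤ (MeasureTheory.Measure.restrict MeasureTheory.volume (Literature.Analysis.FluidPDE.parabolicCylinder r (T, x₀))) = ⊤)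

/-- item stmt-NavierStokesRegularity-2959 · support · rank 9 · closed · proved by Summit.NavierStokesRegularity.NavierStokesRegularity.Theorems.adaptedFrequency_typeIGlue_proof @ 66414e284733 (prover) · by planner
sources: KochNadirashviliSereginSverak2009
PURE LOGIC (theorem typeIGlue_holds in the planner's Sketch.lean, sorry-free; to be copied into
Theorems/): the four route statements plus SingularPointExists imply NoTypeIBlowup. Contrapositive
chain: a non-extendable Type-I solution is maximal, so it has a backward-singular point x₀
(SingularPointExists); AdaptedKernelExists gives t₀, G adapted and comparable at (T,x₀);
AdaptedFrequencyConverges gives Λ₀ with Λ → Λ₀ (instantiate the ∀ H Λ binders with rfl, rfl);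
TangentFlowTransfer gives (C, v, q, K) satisfying the body of FrequencyRigidity with (ν, C, Λ₀);
FrequencyRigidity is ¬∃ of exactly that body: contradiction. -/
@[route_item "route-NavierStokesRegularity-AdaptedFrequency"]
def TypeIGlue : Prop :=
  AdaptedFrequencyConverges → FrequencyRigidity → TangentFlowTransfer → AdaptedKernelExists → SingularPointExists → NoTypeIBlowup

/-- item stmt-NavierStokesRegularity-2960 · assembly · rank 1 · closed · proved by Summit.NavierStokesRegularity.NavierStokesRegularity.Theorems.adaptedFrequency_assembly_proof @ a7ae462167e7 (prover) · by planner
sources: Leray1934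
PURE LOGIC (theorem assembly_holds in Sketch.lean, sorry-free): given the five Type-I items,
NoTypeII (stmt-0056) makes every maximal finite-energy classical solution from Clay data Type-I,
TypeIGlue's argument makes it extend — so no such solution is maximal at any finite T, i.e. NoBlowup
in the exact shape of stmt-0054 — and NoBlowupToClay (stmt-0055) yields NavierStokesRegularity.
Antecedent order: AdaptedFrequencyConverges → FrequencyRigidity → TangentFlowTransfer →
AdaptedKernelExists → SingularPointExists → NoTypeII → NoBlowupToClay → NavierStokesRegularity. -/
@[route_item "route-NavierStokesRegularity-AdaptedFrequency"]
def Assembly : Prop :=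
  AdaptedFrequencyConverges → FrequencyRigidity → TangentFlowTransfer → AdaptedKernelExists → SingularPointExists → NoTypeII → NoBlowupToClay → NavierStokesRegularity

/-! D-0027 §2.1 — DECIDING THEOREM (planner-authored via `route open/edit --closes-file`; by planner-rbadge-NavierStokesRegularity-AdaptedF-b3f1f0f4-g2-0 2026-08-15T16:16:46Z):
its hypotheses are this route's items and its conclusion the sub-problem Statement (glue_lint), and it elaborates with this file. -/

@[closes "route-NavierStokesRegularity-AdaptedFrequency"] theorem closes : AdaptedFrequencyConverges → FrequencyRigidity → TangentFlowTransfer →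
    AdaptedKernelExists → SingularPointExists → NoTypeII → NoBlowupToClay → NavierStokesRegularity := by
  intro hAFC hFR hTFT hAKE hSPE hNT2 hNBC
  refine hNBC ?_
  intro ν T hν hT u p hcl hLH hdec
  by_contra hne
  have hmax : Literature.Analysis.FluidPDE.IsMaximalSmoothSolution ν 0 u p T := ⟨hcl, hne⟩
  have hTI : Literature.Analysis.FluidPDE.IsTypeIBlowup u T := hNT2 ν T hν hT u p hmax hLH hdec
  obtain ⟨x₀, hsing⟩ := hSPE ν T hν hT u p hmax hLH hdec
  obtain ⟨t₀, ht₀, G, hK, hcomp⟩ := hAKE ν T hν hT u p hcl hLH hdec hTI x₀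
  obtain ⟨Λ₀, hlim⟩ := hAFC ν T hν hT u p hcl hLH hdec hTI x₀ t₀ G ht₀ hsing hK hcomp _ _ rfl rfl
  obtain ⟨C, v, q, K, hbody⟩ :=
    hTFT ν T hν hT u p hcl hLH hdec hTI x₀ t₀ G ht₀ hsing hK hcomp _ _ rfl rfl Λ₀ hlim
  exact hFR ⟨ν, C, Λ₀, v, q, K, hν, hbody⟩

end Summit.NavierStokesRegularity.NavierStokesRegularity.Theses.AdaptedFrequency
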